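import Summits.KontsevichZagierPeriods.KontsevichZagierPeriods.Theorems.SymplecticScissorsRealOnePeriodRelationsLoopLayer

/-!
# Crux `RealOnePeriodRelations` (stmt-KontsevichZagierPeriods-10042) — THE LOOP LAYER FOR GENERAL REAL MONIC CUBICS, UNCONDITIONALLY

Line `nash-retraction-thin-strip`, gen-1 lead, continuation c3 (reshape 5), a corollary of the loop layer
(`realOnePeriodRelations_loopLayer_family`): complete real elliptic integrals on ANY real monic cubic model
`y² = F(x) = x³ + a₂x² + a₁x + a₀` over `ℚ̄ ∩ ℝ` (the Legendre cubic `x(x − 1)(x − λ)` included) — ovals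
`∫_{ε₁}^{ε₂} (P₁ + P₂√F + P₃/√F)` over consecutive real roots and branches `∫_ε^∞ c₀/√F` over the largest real root — are
depressed oval / branch cells modulo ONE rule-2 translation `u = x + a₂/3` (`exists_shift`, `shift_oval_cell`,
`shift_branch_cell`, `depress_identity`), hence `realOnePeriodRelations_cubicLayer`: for any finite family of such cubics with
the lattices of their depressed forms (complex multiplication and isogenies allowed) every `ℤ`-combination with vanishing value
of polynomial cells and complete integrals lies in `M₁ = closure (1a ∪ 1b ∪ 2 ∪ Green)`.
[cite: HuberWustholz2022, Thm 13.3 (2), Thm 15.3 (1),(3)] [cite: KontsevichZagier2001, §1.1–§1.2]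
-/

noncomputable section

open scoped BigOperators Polynomial
open Set MeasureTheory MvPolynomial
open Literature.NumberTheory.Transcendental Literature.NumberTheory.Transcendental.CurvePeriods
open Summit.KontsevichZagierPeriods.SymplecticScissors.RealOnePeriodRelationsNegative (M₁ H₁ crux_iff unitDom)

namespace Summit.KontsevichZagierPeriods.SymplecticScissors.RealOnePeriodRelations

namespace LoopLayer

/-- The depressed form of a monic cubic: `F(u − a₂/3) = u³ + (a₁ − a₂²/3)u + (a₀ − a₁a₂/3 + 2a₂³/27)` for
`F = x³ + a₂x² + a₁x + a₀`. [folklore] -/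
theorem depress_identity (a₂ a₁ a₀ u : ℝ) :
    (u - a₂ / 3) ^ 3 + a₂ * (u - a₂ / 3) ^ 2 + a₁ * (u - a₂ / 3) + a₀ =
      u ^ 3 + (a₁ - a₂ ^ 2 / 3) * u + (a₀ - a₁ * a₂ / 3 + 2 * a₂ ^ 3 / 27) := by
  ring

/-- **Translation of a cell by an algebraic shift** (rule 2 along `u = x + σ`): a representation on `{z | z 0 ∈ I}` and the
representation with integrand `u ↦ r(u − σ)` on the shifted set differ by an element of `M₁`; the push-forward is produced by
`helper_cells_1`. Here for the two shapes used below: a bounded cell `(ε₁, ε₂)` and a half-line `(ε, ∞)`. [cite: KontsevichZagier2001, §1.2 rule (2)] -/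
theorem exists_shift (r : KZ.IntegralRep 1) (σ : ℝ) (hσ : IsAlgebraic ℚ σ) :
    ∃ s : KZ.IntegralRep 1, s.domain = (fun p : Fin 1 → ℝ => fun _ : Fin 1 => p 0 + σ) '' r.domain ∧
      (∀ p ∈ r.domain, s.integrand (fun _ => p 0 + σ) = r.integrand p) ∧ KZ.of r - KZ.of s ∈ M₁ := by
  have hd := r.isSemialgebraic_domain
  have h0 : IsSemialgebraicFunOn ℚ r.domain (fun p : Fin 1 → ℝ => p 0) := isSemialgebraicFunOn_apply hd 0
  have hφ : IsSemialgebraicFunOn ℚ r.domain (fun p => (fun x : ℝ => x + σ) (p 0)) :=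
    h0.fun_add (isSemialgebraicFunOn_const_of_isAlgebraic hd hσ)
  have hφ' : IsSemialgebraicFunOn ℚ r.domain (fun p => (fun _ : ℝ => (1 : ℝ)) (p 0)) :=
    isSemialgebraicFunOn_const_of_isAlgebraic hd isAlgebraic_one
  have hder : ∀ p ∈ r.domain, HasDerivAt (fun x : ℝ => x + σ) ((fun _ : ℝ => (1 : ℝ)) (p 0)) (p 0) :=
    fun p _ => (hasDerivAt_id (p 0)).add_const σ
  have hne : ∀ p ∈ r.domain, (fun _ : ℝ => (1 : ℝ)) (p 0) ≠ 0 := fun _ _ => one_ne_zero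
  have hinj : Set.InjOn (fun p : Fin 1 → ℝ => fun _ : Fin 1 => (fun x : ℝ => x + σ) (p 0)) r.domain := by
    intro p _ p' _ h
    have h' : p 0 + σ = p' 0 + σ := congrFun h 0
    rw [KZ.eq_const_apply_zero p, KZ.eq_const_apply_zero p', add_right_cancel h']
  obtain ⟨s, hs, hsi, hrel⟩ := helper_cells_1 r (fun x : ℝ => x + σ) (fun _ : ℝ => (1 : ℝ)) hφ hφ' hder hne hinj
  refine ⟨s, hs, fun p hp => ?_, hrel⟩
  have h := hsi p hp
  simp only [abs_one, div_one] at h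
  exact h

/-- **A general oval cell is a depressed oval cell** (rule 2, `u = x + a₂/3`). [cite: KontsevichZagier2001, §1.2 rule (2)] -/
theorem shift_oval_cell (a₂ a₁ a₀ : ℝ) (ha₂ : IsAlgebraic ℚ a₂) (_ha₁ : IsAlgebraic ℚ a₁) (_ha₀ : IsAlgebraic ℚ a₀)
    {ε₁ ε₂ : ℝ} (hε₁ : IsAlgebraic ℚ ε₁) (hε₂ : IsAlgebraic ℚ ε₂) (hlt : ε₁ < ε₂)
    (hF₁ : ε₁ ^ 3 + a₂ * ε₁ ^ 2 + a₁ * ε₁ + a₀ = 0) (hF₂ : ε₂ ^ 3 + a₂ * ε₂ ^ 2 + a₁ * ε₂ + a₀ = 0)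
    (hpos : ∀ x ∈ Set.Ioo ε₁ ε₂, 0 < x ^ 3 + a₂ * x ^ 2 + a₁ * x + a₀) (P₁ P₂ P₃ : Polynomial (algebraicClosure ℚ ℝ))
    (r : KZ.IntegralRep 1) (hdom : r.domain = {z | z 0 ∈ Set.Ioo ε₁ ε₂})
    (hint : ∀ x ∈ Set.Ioo ε₁ ε₂, r.integrand (fun _ => x) = Polynomial.aeval x P₁ +
      Polynomial.aeval x P₂ * Real.sqrt (x ^ 3 + a₂ * x ^ 2 + a₁ * x + a₀) +
      Polynomial.aeval x P₃ / Real.sqrt (x ^ 3 + a₂ * x ^ 2 + a₁ * x + a₀)) :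
    ∃ ρ : KZ.IntegralRep 1,
      (∃ e₁ e₂ : ℝ, IsAlgebraic ℚ e₁ ∧ IsAlgebraic ℚ e₂ ∧ e₁ < e₂ ∧
        e₁ ^ 3 + (a₁ - a₂ ^ 2 / 3) * e₁ + (a₀ - a₁ * a₂ / 3 + 2 * a₂ ^ 3 / 27) = 0 ∧
        e₂ ^ 3 + (a₁ - a₂ ^ 2 / 3) * e₂ + (a₀ - a₁ * a₂ / 3 + 2 * a₂ ^ 3 / 27) = 0 ∧
        (∀ x ∈ Set.Ioo e₁ e₂, 0 < x ^ 3 + (a₁ - a₂ ^ 2 / 3) * x + (a₀ - a₁ * a₂ / 3 + 2 * a₂ ^ 3 / 27)) ∧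
        ρ.domain = {z | z 0 ∈ Set.Ioo e₁ e₂} ∧
        ∃ Q₁ Q₂ Q₃ : Polynomial (algebraicClosure ℚ ℝ), ∀ x ∈ Set.Ioo e₁ e₂,
          ρ.integrand (fun _ => x) = Polynomial.aeval x Q₁ +
            Polynomial.aeval x Q₂ * Real.sqrt (x ^ 3 + (a₁ - a₂ ^ 2 / 3) * x + (a₀ - a₁ * a₂ / 3 + 2 * a₂ ^ 3 / 27)) +
            Polynomial.aeval x Q₃ / Real.sqrt (x ^ 3 + (a₁ - a₂ ^ 2 / 3) * x + (a₀ - a₁ * a₂ / 3 + 2 * a₂ ^ 3 / 27))) ∧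
      KZ.of r - KZ.of ρ ∈ M₁ := by
  set σ : ℝ := a₂ / 3 with hσ
  have hσalg : IsAlgebraic ℚ σ := by rw [hσ, div_eq_mul_inv]; exact ha₂.mul (isAlgebraic_nat 3).inv
  have hmemσ : σ ∈ algebraicClosure ℚ ℝ := mem_algebraicClosure_iff.2 hσalg
  have hident : ∀ u : ℝ, (u - σ) ^ 3 + a₂ * (u - σ) ^ 2 + a₁ * (u - σ) + a₀ =
      u ^ 3 + (a₁ - a₂ ^ 2 / 3) * u + (a₀ - a₁ * a₂ / 3 + 2 * a₂ ^ 3 / 27) := fun u => depress_identity a₂ a₁ a₀ u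
  have hmemr : ∀ p : Fin 1 → ℝ, p ∈ r.domain ↔ p 0 ∈ Set.Ioo ε₁ ε₂ := fun p => by rw [hdom]; rfl
  obtain ⟨s, hs, hsi, hrel⟩ := exists_shift r σ hσalg
  have hsdom : s.domain = {z | z 0 ∈ Set.Ioo (ε₁ + σ) (ε₂ + σ)} := by
    rw [hs]
    ext z
    constructor
    · rintro ⟨p, hp, rfl⟩
      have hp' := (hmemr p).1 hp
      exact ⟨by simpa using hp'.1, by simpa using hp'.2⟩
    · intro hz
      refine ⟨fun _ => z 0 - σ, (hmemr _).2 ⟨by linarith [hz.1], by linarith [hz.2]⟩, ?_⟩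
      rw [KZ.eq_const_apply_zero z]
      funext
      simp
  set T : Polynomial (algebraicClosure ℚ ℝ) := Polynomial.X - Polynomial.C (⟨σ, hmemσ⟩ : algebraicClosure ℚ ℝ) with hT
  have hT' : ∀ (Q : Polynomial (algebraicClosure ℚ ℝ)) (u : ℝ),
      (Polynomial.aeval u (Q.comp T) : ℝ) = Polynomial.aeval (u - σ) Q := by
    intro Q u
    rw [Polynomial.aeval_comp, hT]
    simp [IntermediateField.algebraMap_apply]
  refine ⟨s, ⟨ε₁ + σ, ε₂ + σ, hε₁.add hσalg, hε₂.add hσalg, by linarith, ?_, ?_, ?_, hsdom,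
    P₁.comp T, P₂.comp T, P₃.comp T, fun u hu => ?_⟩, hrel⟩
  · rw [← hident, add_sub_cancel_right]; exact hF₁
  · rw [← hident, add_sub_cancel_right]; exact hF₂
  · intro x hx
    rw [← hident]
    exact hpos _ ⟨by linarith [hx.1], by linarith [hx.2]⟩
  · have hx : u - σ ∈ Set.Ioo ε₁ ε₂ := ⟨by linarith [hu.1], by linarith [hu.2]⟩
    have h := hsi (fun _ => u - σ) ((hmemr _).2 hx)
    simp only [sub_add_cancel] at h
    rw [h, hint _ hx, hT', hT', hT', hident]

/-- **A general branch cell is a depressed branch cell** (rule 2, `u = x + a₂/3`). [cite: KontsevichZagier2001, §1.2 rule (2)] -/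
theorem shift_branch_cell (a₂ a₁ a₀ : ℝ) (ha₂ : IsAlgebraic ℚ a₂) (_ha₁ : IsAlgebraic ℚ a₁) (_ha₀ : IsAlgebraic ℚ a₀)
    {ε c₀ : ℝ} (hε : IsAlgebraic ℚ ε) (hc₀ : IsAlgebraic ℚ c₀) (hF : ε ^ 3 + a₂ * ε ^ 2 + a₁ * ε + a₀ = 0)
    (hpos : ∀ x : ℝ, ε < x → 0 < x ^ 3 + a₂ * x ^ 2 + a₁ * x + a₀)
    (r : KZ.IntegralRep 1) (hdom : r.domain = {z | ε < z 0})
    (hint : ∀ z ∈ r.domain, r.integrand z = c₀ / Real.sqrt ((z 0) ^ 3 + a₂ * (z 0) ^ 2 + a₁ * (z 0) + a₀)) :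
    ∃ ρ : KZ.IntegralRep 1,
      (∃ e c : ℝ, IsAlgebraic ℚ e ∧ IsAlgebraic ℚ c ∧
        e ^ 3 + (a₁ - a₂ ^ 2 / 3) * e + (a₀ - a₁ * a₂ / 3 + 2 * a₂ ^ 3 / 27) = 0 ∧
        (∀ x : ℝ, e < x → 0 < x ^ 3 + (a₁ - a₂ ^ 2 / 3) * x + (a₀ - a₁ * a₂ / 3 + 2 * a₂ ^ 3 / 27)) ∧
        ρ.domain = {z | e < z 0} ∧
        ∀ z ∈ ρ.domain, ρ.integrand z =
          c / Real.sqrt ((z 0) ^ 3 + (a₁ - a₂ ^ 2 / 3) * (z 0) + (a₀ - a₁ * a₂ / 3 + 2 * a₂ ^ 3 / 27))) ∧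
      KZ.of r - KZ.of ρ ∈ M₁ := by
  set σ : ℝ := a₂ / 3 with hσ
  have hσalg : IsAlgebraic ℚ σ := by rw [hσ, div_eq_mul_inv]; exact ha₂.mul (isAlgebraic_nat 3).inv
  have hident : ∀ u : ℝ, (u - σ) ^ 3 + a₂ * (u - σ) ^ 2 + a₁ * (u - σ) + a₀ =
      u ^ 3 + (a₁ - a₂ ^ 2 / 3) * u + (a₀ - a₁ * a₂ / 3 + 2 * a₂ ^ 3 / 27) := fun u => depress_identity a₂ a₁ a₀ u
  have hmemr : ∀ p : Fin 1 → ℝ, p ∈ r.domain ↔ ε < p 0 := fun p => by rw [hdom]; rfl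
  obtain ⟨s, hs, hsi, hrel⟩ := exists_shift r σ hσalg
  have hsdom : s.domain = {z | ε + σ < z 0} := by
    rw [hs]
    ext z
    constructor
    · rintro ⟨p, hp, rfl⟩
      have hp' := (hmemr p).1 hp
      show ε + σ < p 0 + σ
      linarith
    · intro hz
      refine ⟨fun _ => z 0 - σ, (hmemr _).2 (by show ε < z 0 - σ; linarith [show ε + σ < z 0 from hz]), ?_⟩
      rw [KZ.eq_const_apply_zero z]
      funext
      simp
  refine ⟨s, ⟨ε + σ, c₀, hε.add hσalg, hc₀, ?_, ?_, hsdom, fun z hz => ?_⟩, hrel⟩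
  · rw [← hident, add_sub_cancel_right]; exact hF
  · intro x hx
    rw [← hident]
    exact hpos _ (by linarith)
  · have hz' : ε + σ < z 0 := by rw [hsdom] at hz; exact hz
    have hx : ε < z 0 - σ := by linarith
    have h := hsi (fun _ => z 0 - σ) ((hmemr _).2 hx)
    simp only [sub_add_cancel] at h
    rw [KZ.eq_const_apply_zero z, h, hint _ ((hmemr _).2 hx)]
    simp only
    rw [hident]

/-- **THE LOOP LAYER FOR GENERAL REAL MONIC CUBICS** `F_j = x³ + a₂x² + a₁x + a₀` over `ℚ̄ ∩ ℝ` (the Legendre cubic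
`x(x − 1)(x − λ)` and every real model included), UNCONDITIONALLY: for any finite family, with the lattices of the depressed
forms, every `ℤ`-combination with vanishing value of polynomial cells, complete integrals `∫_{ε₁}^{ε₂} (P₁ + P₂√F_j + P₃/√F_j)`
over real ovals (consecutive real roots) and `∫_ε^∞ c₀/√F_j` over real branches (largest real root) lies in
`M₁ = closure (1a ∪ 1b ∪ 2 ∪ Green)` — by one rule-2 translation per cell (`shift_oval_cell`, `shift_branch_cell`) and
`realOnePeriodRelations_loopLayer_family`. [cite: HuberWustholz2022, Thm 13.3 (2), Thm 15.3] [cite: KontsevichZagier2001, §1.2] -/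
theorem realOnePeriodRelations_cubicLayer : ∀ (n : ℕ) (a₂ a₁ a₀ : Fin n → ℝ), (∀ j, IsAlgebraic ℚ (a₂ j)) →
    (∀ j, IsAlgebraic ℚ (a₁ j)) → (∀ j, IsAlgebraic ℚ (a₀ j)) → ∀ (L : Fin n → PeriodPair),
    (∀ j, (L j).g₂ = -4 * ((a₁ j - a₂ j ^ 2 / 3 : ℝ) : ℂ)) →
    (∀ j, (L j).g₃ = -4 * ((a₀ j - a₁ j * a₂ j / 3 + 2 * a₂ j ^ 3 / 27 : ℝ) : ℂ)) →
    ∀ c : KZ.FormalRep, c ∈ AddSubgroup.closure ((fun r : KZ.IntegralRep 1 => KZ.of r) ''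
      {r | (∃ a b : ℝ, IsAlgebraic ℚ a ∧ IsAlgebraic ℚ b ∧ a < b ∧ r.domain = {z | z 0 ∈ Set.Ioo a b} ∧
            ∃ P : Polynomial (algebraicClosure ℚ ℝ), ∀ x ∈ Set.Ioo a b, r.integrand (fun _ => x) = Polynomial.aeval x P) ∨
        (∃ j, ∃ ε₁ ε₂ : ℝ, IsAlgebraic ℚ ε₁ ∧ IsAlgebraic ℚ ε₂ ∧ ε₁ < ε₂ ∧
          ε₁ ^ 3 + a₂ j * ε₁ ^ 2 + a₁ j * ε₁ + a₀ j = 0 ∧ ε₂ ^ 3 + a₂ j * ε₂ ^ 2 + a₁ j * ε₂ + a₀ j = 0 ∧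
          (∀ x ∈ Set.Ioo ε₁ ε₂, 0 < x ^ 3 + a₂ j * x ^ 2 + a₁ j * x + a₀ j) ∧ r.domain = {z | z 0 ∈ Set.Ioo ε₁ ε₂} ∧
          ∃ P₁ P₂ P₃ : Polynomial (algebraicClosure ℚ ℝ), ∀ x ∈ Set.Ioo ε₁ ε₂,
            r.integrand (fun _ => x) = Polynomial.aeval x P₁ +
              Polynomial.aeval x P₂ * Real.sqrt (x ^ 3 + a₂ j * x ^ 2 + a₁ j * x + a₀ j) +
              Polynomial.aeval x P₃ / Real.sqrt (x ^ 3 + a₂ j * x ^ 2 + a₁ j * x + a₀ j)) ∨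
        (∃ j, ∃ ε c₀ : ℝ, IsAlgebraic ℚ ε ∧ IsAlgebraic ℚ c₀ ∧ ε ^ 3 + a₂ j * ε ^ 2 + a₁ j * ε + a₀ j = 0 ∧
          (∀ x : ℝ, ε < x → 0 < x ^ 3 + a₂ j * x ^ 2 + a₁ j * x + a₀ j) ∧ r.domain = {z | ε < z 0} ∧
          ∀ z ∈ r.domain, r.integrand z = c₀ / Real.sqrt ((z 0) ^ 3 + a₂ j * (z 0) ^ 2 + a₁ j * (z 0) + a₀ j))}) →
    KZ.eval c = 0 →
    c ∈ AddSubgroup.closure (KZ.domainAddRel ∪ KZ.integrandAddRel ∪ KZ.changeOfVariablesRel ∪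
      {g : KZ.FormalRep | ∃ (Δ : Set (Fin 2 → ℝ)) (A B S : (Fin 2 → ℝ) → ℝ) (r₀₁ r₁₂ r₀₂ : KZ.IntegralRep 1),
        Δ = {p | 0 ≤ p 0 ∧ 0 ≤ p 1 ∧ p 0 + p 1 ≤ 1} ∧ IsSemialgebraicFunOn ℚ Δ A ∧ IsSemialgebraicFunOn ℚ Δ B ∧
        ContinuousOn A Δ ∧ ContinuousOn B Δ ∧
        (∀ p : Fin 2 → ℝ, 0 < p 0 → 0 < p 1 → p 0 + p 1 < 1 →
          HasFDerivAt S (A p • ContinuousLinearMap.proj (R := ℝ) (φ := fun _ : Fin 2 => ℝ) 0 +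
            B p • ContinuousLinearMap.proj (R := ℝ) (φ := fun _ : Fin 2 => ℝ) 1) p) ∧
        r₀₁.domain = {z | z 0 ∈ Set.Ioo 0 1} ∧ r₁₂.domain = {z | z 0 ∈ Set.Ioo 0 1} ∧
        r₀₂.domain = {z | z 0 ∈ Set.Ioo 0 1} ∧ (∀ z ∈ r₀₁.domain, r₀₁.integrand z = A ![z 0, 0]) ∧
        (∀ z ∈ r₁₂.domain, r₁₂.integrand z = B ![1 - z 0, z 0] - A ![1 - z 0, z 0]) ∧
        (∀ z ∈ r₀₂.domain, r₀₂.integrand z = B ![0, z 0]) ∧ g = KZ.of r₀₁ + KZ.of r₁₂ - KZ.of r₀₂}) := by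
  intro n a₂ a₁ a₀ ha₂ ha₁ ha₀ L hL₂ hL₃ c hc heval
  change c ∈ M₁
  set A : Fin n → ℝ := fun j => a₁ j - a₂ j ^ 2 / 3 with hA
  set B : Fin n → ℝ := fun j => a₀ j - a₁ j * a₂ j / 3 + 2 * a₂ j ^ 3 / 27 with hB
  have h3 : IsAlgebraic ℚ (3 : ℝ)⁻¹ := (isAlgebraic_nat 3).inv
  have h27 : IsAlgebraic ℚ (27 : ℝ)⁻¹ := (isAlgebraic_nat 27).inv
  have hAalg : ∀ j, IsAlgebraic ℚ (A j) := fun j => by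
    simp only [hA, div_eq_mul_inv]
    exact (ha₁ j).sub (((ha₂ j).pow 2).mul h3)
  have hBalg : ∀ j, IsAlgebraic ℚ (B j) := fun j => by
    simp only [hB, div_eq_mul_inv]
    exact ((ha₀ j).sub (((ha₁ j).mul (ha₂ j)).mul h3)).add (((isAlgebraic_nat 2).mul ((ha₂ j).pow 3)).mul h27)
  have key : ∀ c : KZ.FormalRep, c ∈ AddSubgroup.closure ((fun r : KZ.IntegralRep 1 => KZ.of r) ''
      {r | (∃ a b : ℝ, IsAlgebraic ℚ a ∧ IsAlgebraic ℚ b ∧ a < b ∧ r.domain = {z | z 0 ∈ Set.Ioo a b} ∧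
            ∃ P : Polynomial (algebraicClosure ℚ ℝ), ∀ x ∈ Set.Ioo a b, r.integrand (fun _ => x) = Polynomial.aeval x P) ∨
        (∃ j, ∃ ε₁ ε₂ : ℝ, IsAlgebraic ℚ ε₁ ∧ IsAlgebraic ℚ ε₂ ∧ ε₁ < ε₂ ∧
          ε₁ ^ 3 + a₂ j * ε₁ ^ 2 + a₁ j * ε₁ + a₀ j = 0 ∧ ε₂ ^ 3 + a₂ j * ε₂ ^ 2 + a₁ j * ε₂ + a₀ j = 0 ∧
          (∀ x ∈ Set.Ioo ε₁ ε₂, 0 < x ^ 3 + a₂ j * x ^ 2 + a₁ j * x + a₀ j) ∧ r.domain = {z | z 0 ∈ Set.Ioo ε₁ ε₂} ∧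
          ∃ P₁ P₂ P₃ : Polynomial (algebraicClosure ℚ ℝ), ∀ x ∈ Set.Ioo ε₁ ε₂,
            r.integrand (fun _ => x) = Polynomial.aeval x P₁ +
              Polynomial.aeval x P₂ * Real.sqrt (x ^ 3 + a₂ j * x ^ 2 + a₁ j * x + a₀ j) +
              Polynomial.aeval x P₃ / Real.sqrt (x ^ 3 + a₂ j * x ^ 2 + a₁ j * x + a₀ j)) ∨
        (∃ j, ∃ ε c₀ : ℝ, IsAlgebraic ℚ ε ∧ IsAlgebraic ℚ c₀ ∧ ε ^ 3 + a₂ j * ε ^ 2 + a₁ j * ε + a₀ j = 0 ∧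
          (∀ x : ℝ, ε < x → 0 < x ^ 3 + a₂ j * x ^ 2 + a₁ j * x + a₀ j) ∧ r.domain = {z | ε < z 0} ∧
          ∀ z ∈ r.domain, r.integrand z = c₀ / Real.sqrt ((z 0) ^ 3 + a₂ j * (z 0) ^ 2 + a₁ j * (z 0) + a₀ j))}) →
      ∃ c' : KZ.FormalRep, c' ∈ AddSubgroup.closure ((fun r : KZ.IntegralRep 1 => KZ.of r) ''
      {r | (∃ a b : ℝ, IsAlgebraic ℚ a ∧ IsAlgebraic ℚ b ∧ a < b ∧ r.domain = {z | z 0 ∈ Set.Ioo a b} ∧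
            ∃ P : Polynomial (algebraicClosure ℚ ℝ), ∀ x ∈ Set.Ioo a b, r.integrand (fun _ => x) = Polynomial.aeval x P) ∨
        (∃ j, ∃ e₁ e₂ : ℝ, IsAlgebraic ℚ e₁ ∧ IsAlgebraic ℚ e₂ ∧ e₁ < e₂ ∧ e₁ ^ 3 + A j * e₁ + B j = 0 ∧
          e₂ ^ 3 + A j * e₂ + B j = 0 ∧ (∀ x ∈ Set.Ioo e₁ e₂, 0 < x ^ 3 + A j * x + B j) ∧
          r.domain = {z | z 0 ∈ Set.Ioo e₁ e₂} ∧
          ∃ P₁ P₂ P₃ : Polynomial (algebraicClosure ℚ ℝ), ∀ x ∈ Set.Ioo e₁ e₂,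
            r.integrand (fun _ => x) = Polynomial.aeval x P₁ + Polynomial.aeval x P₂ * Real.sqrt (x ^ 3 + A j * x + B j) +
              Polynomial.aeval x P₃ / Real.sqrt (x ^ 3 + A j * x + B j)) ∨
        (∃ j, ∃ e c₀ : ℝ, IsAlgebraic ℚ e ∧ IsAlgebraic ℚ c₀ ∧ e ^ 3 + A j * e + B j = 0 ∧
          (∀ x : ℝ, e < x → 0 < x ^ 3 + A j * x + B j) ∧ r.domain = {z | e < z 0} ∧
          ∀ z ∈ r.domain, r.integrand z = c₀ / Real.sqrt ((z 0) ^ 3 + A j * (z 0) + B j))}) ∧ c - c' ∈ M₁ := by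
    intro c hc
    refine AddSubgroup.closure_induction (p := fun c _ => ∃ c' : KZ.FormalRep, c' ∈ _ ∧ c - c' ∈ M₁) ?_ ?_ ?_ ?_ hc
    · rintro _ ⟨r, hr, rfl⟩
      rcases hr with hpoly | ⟨j, ε₁, ε₂, hε₁, hε₂, hlt, hF₁, hF₂, hpos, hdom, P₁, P₂, P₃, hint⟩ |
        ⟨j, ε, c₀, hε, hc₀, hF, hpos, hdom, hint⟩
      · exact ⟨KZ.of r, AddSubgroup.subset_closure ⟨r, Or.inl hpoly, rfl⟩, by rw [sub_self]; exact M₁.zero_mem⟩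
      · obtain ⟨ρ, hρ, hrel⟩ := shift_oval_cell (a₂ j) (a₁ j) (a₀ j) (ha₂ j) (ha₁ j) (ha₀ j) hε₁ hε₂ hlt hF₁ hF₂ hpos
          P₁ P₂ P₃ r hdom hint
        exact ⟨KZ.of ρ, AddSubgroup.subset_closure ⟨ρ, Or.inr (Or.inl ⟨j, hρ⟩), rfl⟩, hrel⟩
      · obtain ⟨ρ, hρ, hrel⟩ := shift_branch_cell (a₂ j) (a₁ j) (a₀ j) (ha₂ j) (ha₁ j) (ha₀ j) hε hc₀ hF hpos r hdom hint
        exact ⟨KZ.of ρ, AddSubgroup.subset_closure ⟨ρ, Or.inr (Or.inr ⟨j, hρ⟩), rfl⟩, hrel⟩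
    · exact ⟨0, AddSubgroup.zero_mem _, by rw [sub_self]; exact M₁.zero_mem⟩
    · rintro c₁ c₂ _ _ ⟨c₁', h₁', h₁⟩ ⟨c₂', h₂', h₂⟩
      refine ⟨c₁' + c₂', AddSubgroup.add_mem _ h₁' h₂', ?_⟩
      have e : c₁ + c₂ - (c₁' + c₂') = (c₁ - c₁') + (c₂ - c₂') := by abel
      rw [e]
      exact M₁.add_mem h₁ h₂
    · rintro c₁ _ ⟨c₁', h₁', h₁⟩
      refine ⟨-c₁', AddSubgroup.neg_mem _ h₁', ?_⟩
      have e : -c₁ - -c₁' = -(c₁ - c₁') := by abel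
      rw [e]
      exact M₁.neg_mem h₁
  obtain ⟨c', hc', hcc'⟩ := key c hc
  have heval' : KZ.eval c' = 0 := by
    have h := Summit.KontsevichZagierPeriods.SymplecticScissors.RealOnePeriodRelationsNegative.eval_eq_zero_of_mem_M₁ hcc'
    rw [map_sub, heval, zero_sub, neg_eq_zero] at h
    exact h
  have hM : c' ∈ M₁ :=
    realOnePeriodRelations_loopLayer_family n A B hAalg hBalg L (fun j => by rw [hL₂ j]) (fun j => by rw [hL₃ j])
      c' hc' heval'
  have e : c = (c - c') + c' := by abel
  rw [e]
  exact M₁.add_mem hcc' hM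

end LoopLayer

end Summit.KontsevichZagierPeriods.SymplecticScissors.RealOnePeriodRelations

end
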